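import Mathlib

/-!
# Orientation of a continuous field of complex structures on the plane

Helper file for stub `helper_structureInjective` of line `Sketch`, crux `TameOrBrodyR4`
(stmt-SmoothPoincare4-7826, route SullivanDual), skeleton v13.

A continuous field `j` of complex structures on `ℝ² = ℂ` (`j η ∘ j η = -id`) which is the
standard structure (multiplication by `I`) outside a disc lies in the connected component of `I`
at every point: the sign `(j η 1).im` never vanishes, is `1` far out, hence is positive
everywhere by connectedness of `ℂ`. Consequently the `ℝ`-linear map `v ↦ v - I * j η v`
(which intertwines `j η` with `I`) is injective for every `η`; it fails to be injective exactly
when `j η = -I`.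
-/

noncomputable section

open Set

-- the registered namespace `Summit.SmoothPoincare4.SmoothPoincare4.…` repeats a component
set_option linter.dupNamespace false

namespace Summit.SmoothPoincare4.SmoothPoincare4.Cruxes.TameOrBrodyR4.Sketch

namespace StructureInjective

/-- A complex structure `J` on `ℂ = ℝ²` (an `ℝ`-linear map with `J ∘ J = -id`) has
`(J 1).im ≠ 0`: otherwise `J 1 = a` would be real and `J (J 1) = a² ≠ -1`. -/
theorem im_apply_one_ne_zero (J : ℂ →L[ℝ] ℂ) (hJ : ∀ v, J (J v) = -v) : (J 1).im ≠ 0 := by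
  intro h0
  obtain ⟨a, ha⟩ : ∃ a : ℝ, J 1 = (a : ℂ) :=
    ⟨(J 1).re, Complex.ext (by simp) (by simp [h0])⟩
  have h2 : J (J 1) = ((a * a : ℝ) : ℂ) := by
    have h1 : J 1 = (a : ℝ) • (1 : ℂ) := by rw [ha, Complex.real_smul, mul_one]
    conv_lhs => rw [h1, map_smul, ha, Complex.real_smul]
    rw [Complex.ofReal_mul]
  have h3 := hJ 1
  rw [h2] at h3
  have h4 := congrArg Complex.re h3
  simp only [Complex.ofReal_re, Complex.neg_re, Complex.one_re] at h4
  nlinarith [mul_self_nonneg a]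

/-- For a continuous field `j` of complex structures on `ℂ = ℝ²`, standard outside the disc of
radius `ρ₁`, the sign `(j η 1).im` is positive everywhere (intermediate value theorem on the
connected space `ℂ`, using `im_apply_one_ne_zero`). -/
theorem im_apply_one_pos (j : ℂ → (ℂ →L[ℝ] ℂ)) (ρ₁ : ℝ) (hj : Continuous j)
    (hjj : ∀ η v, j η (j η v) = -v) (hfar : ∀ η : ℂ, ρ₁ ≤ ‖η‖ → ∀ v, j η v = Complex.I * v)
    (η : ℂ) : 0 < (j η 1).im := by
  have hσ : Continuous fun η => (j η 1).im :=
    Complex.continuous_im.comp (hj.clm_apply continuous_const)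
  obtain ⟨η₁, hη₁⟩ : ∃ η₁ : ℂ, ρ₁ ≤ ‖η₁‖ :=
    ⟨((max ρ₁ 1 : ℝ) : ℂ), by
      rw [Complex.norm_of_nonneg (le_trans zero_le_one (le_max_right _ _))]
      exact le_max_left _ _⟩
  have hσ₁ : (j η₁ 1).im = 1 := by
    rw [hfar η₁ hη₁ 1, mul_one, Complex.I_im]
  by_contra hneg
  have hle : (j η 1).im ≤ 0 := not_lt.mp hneg
  have hmem : (0 : ℝ) ∈ Icc ((fun η => (j η 1).im) η) ((fun η => (j η 1).im) η₁) :=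
    ⟨hle, by simp only [hσ₁]; exact zero_le_one⟩
  obtain ⟨ζ, hζ⟩ := intermediate_value_univ η η₁ hσ hmem
  exact im_apply_one_ne_zero (j ζ) (hjj ζ) hζ

end StructureInjective

/-- (J5) a continuous field of complex structures on `ℝ² = ℂ`, standard near infinity, is
positively oriented everywhere: `v ↦ v - i j v` is injective. Indeed, a non-zero `v` in the
kernel gives `j η v = -I v`, `j η (I v) = v`; writing `1` in the real basis `{v, I v}` yields
`j η 1 = -I`, so `(j η 1).im = -1 < 0`, contradicting `StructureInjective.im_apply_one_pos`. -/
theorem helper_structureInjective (j : ℂ → (ℂ →L[ℝ] ℂ)) (ρ₁ : ℝ) (hj : Continuous j)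
    (hjj : ∀ η v, j η (j η v) = -v) (hfar : ∀ η : ℂ, ρ₁ ≤ ‖η‖ → ∀ v, j η v = Complex.I * v) :
    ∀ η v, v - Complex.I * j η v = 0 → v = 0 := by
  intro η v hv
  by_contra hne
  have hpos := StructureInjective.im_apply_one_pos j ρ₁ hj hjj hfar η
  -- `j η` acts on the real basis `{v, I v}` as `-I`
  have h1 : j η v = -Complex.I * v := by
    linear_combination Complex.I * hv + (j η v) * Complex.I_mul_I
  have h2 : j η (Complex.I * v) = v := by
    have h := hjj η v
    rw [h1, neg_mul, map_neg, neg_inj] at h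
    exact h
  -- coordinates of `1` in the real basis `{v, I v}`
  obtain ⟨a, b, hc⟩ : ∃ a b : ℝ, v⁻¹ = (a : ℂ) + (b : ℂ) * Complex.I :=
    ⟨_, _, (Complex.re_add_im _).symm⟩
  have hdec : (1 : ℂ) = (a : ℂ) * v + (b : ℂ) * (Complex.I * v) := by
    calc (1 : ℂ) = v⁻¹ * v := (inv_mul_cancel₀ hne).symm
      _ = (a : ℂ) * v + (b : ℂ) * (Complex.I * v) := by rw [hc]; ring
  have hlin : j η ((a : ℝ) • v + (b : ℝ) • (Complex.I * v)) =
      (a : ℝ) • j η v + (b : ℝ) • j η (Complex.I * v) := by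
    rw [map_add, map_smul, map_smul]
  simp only [Complex.real_smul] at hlin
  rw [← hdec, h1, h2] at hlin
  have hj1 : j η 1 = -Complex.I := by
    rw [hlin]
    linear_combination Complex.I * hdec + ((b : ℂ) * v) * Complex.I_mul_I
  rw [hj1, Complex.neg_im, Complex.I_im] at hpos
  norm_num at hpos

end Summit.SmoothPoincare4.SmoothPoincare4.Cruxes.TameOrBrodyR4.Sketch
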